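import Summits.FinalStateConjecture.FinalStateConjecture.Theorems.PhotonSphereChannelsPicard

/-!
# Route PhotonSphereChannels — the Picard series converges in `C²` to a solution (well-posedness, V)

From the geometric bounds of `PhotonSphereChannelsPicard`: on each open triangle `{|x| + |t| < R}` the
series `Σ δ n`, `Σ ∂δ n`, `Σ ∂²δ n` converge uniformly (Weierstrass M-test, operator norms from
`opNorm_le_of_apply_le` / `opNorm₂_le_of_apply_le`), so by `hasFDerivAt_of_tendstoUniformlyOn`
the pointwise sum `ψ = Σ δ n` has `∂ψ = Σ ∂δ n`, `∂²ψ = Σ ∂²δ n`, the latter continuous, i.e.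
`ψ ∈ C²` (`picard_uniform`, `picard_limit`); summing the iterate equations `□δ 0 = 0`,
`□δ (n+1) = −Vδ n` gives `□ψ + Vψ = 0` with the Cauchy data of `ψ₀` (`picard_solution`).
The free solution with odd data `(0, g)`, `g ∈ C¹` — `u₀ = ½(G(x+t) − G(x−t))`, `G' = g` — is `C²`,
solves `□u₀ = 0` and has `u₀(0,·) = 0`, `∂u₀(0,x)(v) = v₁ g(x)` (`free_solution_odd`, d'Alembert).
Endpoint: `exists_solution_odd_data` — for `V ∈ C¹` (no boundedness needed) and `g ∈ C¹` there is
a global `C²` solution of `ψ_tt − ψ_xx + Vψ = 0` with Cauchy data `(0, g)` (Fréchet form on `ℝ × ℝ`;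
the tree's `CauchyWave.exists_solution`, characteristic Volterra method, treats general data for
BOUNDED `V`).  No new definitions. [folklore]
-/

namespace Summit.FinalStateConjecture.FinalStateConjecture.Theorems

open MeasureTheory Set Filter Topology intervalIntegral
open scoped ContDiff Interval

noncomputable section

namespace WaveEnergy

/-! ### The limit of the Picard scheme is a `C²` solution -/

section PicardLimit

variable {V : ℝ → ℝ} {ψ₀ : ℝ × ℝ → ℝ} {δ : ℕ → ℝ × ℝ → ℝ}

/-- Operator norm on `ℝ × ℝ →L ℝ` from a bound of the form `|φ v| ≤ (|v₁| + |v₂|) K`. -/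
theorem opNorm_le_of_apply_le (φ : ℝ × ℝ →L[ℝ] ℝ) {K : ℝ} (hK : 0 ≤ K)
    (h : ∀ v, |φ v| ≤ (|v.1| + |v.2|) * K) : ‖φ‖ ≤ 2 * K := by
  refine ContinuousLinearMap.opNorm_le_bound _ (by positivity) fun v => ?_
  rw [Real.norm_eq_abs]
  refine (h v).trans ?_
  have h1 : |v.1| ≤ ‖v‖ := by rw [← Real.norm_eq_abs]; exact norm_fst_le v
  have h2 : |v.2| ≤ ‖v‖ := by rw [← Real.norm_eq_abs]; exact norm_snd_le v
  nlinarith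

/-- Operator norm on `ℝ × ℝ →L ℝ × ℝ →L ℝ` from a bound `|T v w| ≤ (|v₁|+|v₂|)(|w₁|+|w₂|) K`. -/
theorem opNorm₂_le_of_apply_le (T : ℝ × ℝ →L[ℝ] ℝ × ℝ →L[ℝ] ℝ) {K : ℝ} (hK : 0 ≤ K)
    (h : ∀ v w, |T v w| ≤ (|v.1| + |v.2|) * (|w.1| + |w.2|) * K) : ‖T‖ ≤ 4 * K := by
  refine ContinuousLinearMap.opNorm_le_bound _ (by positivity) fun v => ?_
  have h1 : |v.1| ≤ ‖v‖ := by rw [← Real.norm_eq_abs]; exact norm_fst_le v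
  have h2 : |v.2| ≤ ‖v‖ := by rw [← Real.norm_eq_abs]; exact norm_snd_le v
  have hv : 0 ≤ (|v.1| + |v.2|) * K := by positivity
  refine (opNorm_le_of_apply_le (T v) hv fun w => ?_).trans (by nlinarith)
  calc |T v w| ≤ (|v.1| + |v.2|) * (|w.1| + |w.2|) * K := h v w
    _ = (|w.1| + |w.2|) * ((|v.1| + |v.2|) * K) := by ring

/-- **Uniform convergence of the Picard series on an open triangle** (one `R`): from geometric
bounds `‖δ n‖, ‖∂δ n‖, ‖∂²δ n‖ ≤ c 2⁻ⁿ` on `S = {|x| + |t| < R}`, the three series converge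
uniformly on `S`, the sums `ψ = Σ δ n`, `g' = Σ ∂δ n` satisfy `∂ψ = g'`, `∂g' = g'' = Σ ∂²δ n` on
`S`, and `g''` is continuous on `S`. [folklore] -/
theorem picard_uniform {δ : ℕ → ℝ × ℝ → ℝ} (hd1 : ∀ n, Differentiable ℝ (δ n))
    (hd2 : ∀ n, Differentiable ℝ (fderiv ℝ (δ n))) (hc2 : ∀ n, Continuous (fderiv ℝ (fderiv ℝ (δ n))))
    {S : Set (ℝ × ℝ)} (hSo : IsOpen S) {c₀ c₁ c₂ : ℝ}
    (hb0 : ∀ n, ∀ z ∈ S, ‖δ n z‖ ≤ c₀ * (1 / 2) ^ n)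
    (hb1 : ∀ n, ∀ z ∈ S, ‖fderiv ℝ (δ n) z‖ ≤ c₁ * (1 / 2) ^ n)
    (hb2 : ∀ n, ∀ z ∈ S, ‖fderiv ℝ (fderiv ℝ (δ n)) z‖ ≤ c₂ * (1 / 2) ^ n) :
    (∀ z ∈ S, HasFDerivAt (fun z => ∑' n, δ n z) (∑' n, fderiv ℝ (δ n) z) z) ∧
    (∀ z ∈ S, HasFDerivAt (fun z => ∑' n, fderiv ℝ (δ n) z) (∑' n, fderiv ℝ (fderiv ℝ (δ n)) z) z) ∧
    ContinuousOn (fun z => ∑' n, fderiv ℝ (fderiv ℝ (δ n)) z) S := by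
  have hs0 : Summable fun n : ℕ => c₀ * (1 / 2 : ℝ) ^ n := summable_geometric_two.mul_left c₀
  have hs1 : Summable fun n : ℕ => c₁ * (1 / 2 : ℝ) ^ n := summable_geometric_two.mul_left c₁
  have hs2 : Summable fun n : ℕ => c₂ * (1 / 2 : ℝ) ^ n := summable_geometric_two.mul_left c₂
  have hU0 : TendstoUniformlyOn (fun N z => ∑ n ∈ Finset.range N, δ n z) (fun z => ∑' n, δ n z)
      atTop S := tendstoUniformlyOn_tsum_nat hs0 hb0
  have hU1 : TendstoUniformlyOn (fun N z => ∑ n ∈ Finset.range N, fderiv ℝ (δ n) z)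
      (fun z => ∑' n, fderiv ℝ (δ n) z) atTop S := tendstoUniformlyOn_tsum_nat hs1 hb1
  have hU2 : TendstoUniformlyOn (fun N z => ∑ n ∈ Finset.range N, fderiv ℝ (fderiv ℝ (δ n)) z)
      (fun z => ∑' n, fderiv ℝ (fderiv ℝ (δ n)) z) atTop S :=
    tendstoUniformlyOn_tsum_nat (f := fun n z => fderiv ℝ (fderiv ℝ (δ n)) z) hs2 hb2
  have hD0 : ∀ N : ℕ, ∀ z ∈ S, HasFDerivAt (fun z => ∑ n ∈ Finset.range N, δ n z)
      (∑ n ∈ Finset.range N, fderiv ℝ (δ n) z) z :=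
    fun N z _ => HasFDerivAt.fun_sum fun n _ => (hd1 n z).hasFDerivAt
  have hD1 : ∀ N : ℕ, ∀ z ∈ S, HasFDerivAt (fun z => ∑ n ∈ Finset.range N, fderiv ℝ (δ n) z)
      (∑ n ∈ Finset.range N, fderiv ℝ (fderiv ℝ (δ n)) z) z :=
    fun N z _ => HasFDerivAt.fun_sum fun n _ => (hd2 n z).hasFDerivAt
  refine ⟨fun z hz => hasFDerivAt_of_tendstoUniformlyOn hSo hU1 hD0 (fun z hz => hU0.tendsto_at hz) hz,
    fun z hz => hasFDerivAt_of_tendstoUniformlyOn hSo hU2 hD1 (fun z hz => hU1.tendsto_at hz) hz, ?_⟩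
  have : ContinuousAdd (ℝ × ℝ →L[ℝ] ℝ × ℝ →L[ℝ] ℝ) := by
    have h := (inferInstance : IsTopologicalAddGroup (ℝ × ℝ →L[ℝ] ℝ × ℝ →L[ℝ] ℝ)).toContinuousAdd
    exact h
  exact hU2.continuousOn (Frequently.of_forall fun N =>
    (continuous_finsetSum _ fun n _ => hc2 n).continuousOn)

/-- **The Picard series converges in `C²`**: with `ψ = Σ δ n` (pointwise `tsum`), `ψ ∈ C²`, and
its first and second Fréchet derivatives are the (summable) sums of those of the iterates.
[folklore] -/
theorem picard_limit (hV : ContDiff ℝ 1 V) (hψ₀ : ContDiff ℝ 2 ψ₀) (hδ0 : δ 0 = ψ₀)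
    (hδ : ∀ n t x, δ (n + 1) (t, x) = (1 / 2) * ∫ s in (0 : ℝ)..t,
      ((∫ y in (0 : ℝ)..(x + (t - s)), -(V y * δ n (s, y)))
        - ∫ y in (0 : ℝ)..(x - (t - s)), -(V y * δ n (s, y)))) :
    ContDiff ℝ 2 (fun z => ∑' n, δ n z) ∧
    (∀ z : ℝ × ℝ, Summable fun n => δ n z) ∧
    (∀ z : ℝ × ℝ, (Summable fun n => fderiv ℝ (δ n) z) ∧
      fderiv ℝ (fun z => ∑' n, δ n z) z = ∑' n, fderiv ℝ (δ n) z) ∧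
    (∀ z : ℝ × ℝ, (Summable fun n => fderiv ℝ (fderiv ℝ (δ n)) z) ∧
      fderiv ℝ (fderiv ℝ (fun z => ∑' n, δ n z)) z = ∑' n, fderiv ℝ (fderiv ℝ (δ n)) z) := by
  have hreg := contDiff_picard hV hψ₀ hδ0 hδ
  have hd1 : ∀ n, Differentiable ℝ (δ n) := fun n => (hreg n).differentiable (by norm_num)
  have hd2 : ∀ n, Differentiable ℝ (fderiv ℝ (δ n)) := fun n =>
    ((hreg n).fderiv_right (m := 1) (by norm_num)).differentiable (by norm_num)
  have hc2 : ∀ n, Continuous (fderiv ℝ (fderiv ℝ (δ n))) := fun n =>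
    ((hreg n).fderiv_right (m := 1) (by norm_num)).continuous_fderiv (by norm_num)
  -- per-triangle facts
  have hloc : ∀ R : ℝ, 0 < R →
      (∀ z : ℝ × ℝ, |z.2| + |z.1| < R →
        HasFDerivAt (fun z => ∑' n, δ n z) (∑' n, fderiv ℝ (δ n) z) z ∧
        HasFDerivAt (fun z => ∑' n, fderiv ℝ (δ n) z) (∑' n, fderiv ℝ (fderiv ℝ (δ n)) z) z) ∧
      ContinuousOn (fun z => ∑' n, fderiv ℝ (fderiv ℝ (δ n)) z) {z : ℝ × ℝ | |z.2| + |z.1| < R} ∧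
      (∀ z : ℝ × ℝ, |z.2| + |z.1| < R → (Summable fun n => δ n z) ∧
        (Summable fun n => fderiv ℝ (δ n) z) ∧ Summable fun n => fderiv ℝ (fderiv ℝ (δ n)) z) := by
    intro R hR
    obtain ⟨L, hL, A₀, A₁, A₂, hA₀, hA₁, hA₂, hbd⟩ := picard_bounds hV hψ₀ hδ0 hδ hR.le
    have hSo : IsOpen {z : ℝ × ℝ | |z.2| + |z.1| < R} := isOpen_lt (by fun_prop) continuous_const
    have hexp : ∀ z : ℝ × ℝ, |z.2| + |z.1| < R → Real.exp (L * |z.1|) ≤ Real.exp (L * R) := by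
      intro z hz
      apply Real.exp_le_exp.2
      have : |z.1| ≤ R := by linarith [abs_nonneg z.2]
      exact mul_le_mul_of_nonneg_left this hL.le
    have hb0 : ∀ n, ∀ z ∈ {z : ℝ × ℝ | |z.2| + |z.1| < R},
        ‖δ n z‖ ≤ A₀ * Real.exp (L * R) * (1 / 2) ^ n := by
      intro n z hz
      rw [Real.norm_eq_abs]
      refine (hbd n z (le_of_lt hz)).1.trans ?_
      have := hexp z hz
      have h2 : 0 ≤ A₀ * (1 / 2 : ℝ) ^ n := by positivity
      nlinarith
    have hb1 : ∀ n, ∀ z ∈ {z : ℝ × ℝ | |z.2| + |z.1| < R},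
        ‖fderiv ℝ (δ n) z‖ ≤ 2 * A₁ * Real.exp (L * R) * (1 / 2) ^ n := by
      intro n z hz
      have h := opNorm_le_of_apply_le (fderiv ℝ (δ n) z) (K := A₁ * (1 / 2) ^ n * Real.exp (L * |z.1|))
        (by positivity) (fun v => by
          have := (hbd n z (le_of_lt hz)).2.1 v
          linarith)
      refine h.trans ?_
      have := hexp z hz
      have h2 : 0 ≤ A₁ * (1 / 2 : ℝ) ^ n := by positivity
      nlinarith
    have hb2 : ∀ n, ∀ z ∈ {z : ℝ × ℝ | |z.2| + |z.1| < R},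
        ‖fderiv ℝ (fderiv ℝ (δ n)) z‖ ≤ 4 * A₂ * Real.exp (L * R) * (1 / 2) ^ n := by
      intro n z hz
      have h := opNorm₂_le_of_apply_le (fderiv ℝ (fderiv ℝ (δ n)) z)
        (K := A₂ * (1 / 2) ^ n * Real.exp (L * |z.1|)) (by positivity) (fun v w => by
          have := (hbd n z (le_of_lt hz)).2.2 v w
          linarith)
      refine h.trans ?_
      have := hexp z hz
      have h2 : 0 ≤ A₂ * (1 / 2 : ℝ) ^ n := by positivity
      nlinarith
    obtain ⟨hF0, hF1, hcont⟩ := picard_uniform hd1 hd2 hc2 hSo (c₀ := A₀ * Real.exp (L * R))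
      (c₁ := 2 * A₁ * Real.exp (L * R)) (c₂ := 4 * A₂ * Real.exp (L * R)) hb0 hb1 hb2
    have hs0 : Summable fun n : ℕ => A₀ * Real.exp (L * R) * (1 / 2 : ℝ) ^ n :=
      summable_geometric_two.mul_left _
    have hs1 : Summable fun n : ℕ => 2 * A₁ * Real.exp (L * R) * (1 / 2 : ℝ) ^ n :=
      summable_geometric_two.mul_left _
    have hs2 : Summable fun n : ℕ => 4 * A₂ * Real.exp (L * R) * (1 / 2 : ℝ) ^ n :=
      summable_geometric_two.mul_left _
    refine ⟨fun z hz => ⟨hF0 z hz, hF1 z hz⟩, hcont, fun z hz => ⟨?_, ?_, ?_⟩⟩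
    · exact Summable.of_norm_bounded hs0 (fun n => hb0 n z hz)
    · exact Summable.of_norm_bounded hs1 (fun n => hb1 n z hz)
    · exact Summable.of_norm_bounded (E := ℝ × ℝ →L[ℝ] ℝ × ℝ →L[ℝ] ℝ) hs2 (fun n => hb2 n z hz)
  -- globalise
  have hmem : ∀ z : ℝ × ℝ, |z.2| + |z.1| < |z.2| + |z.1| + 1 := fun z => by linarith
  have hpos : ∀ z : ℝ × ℝ, 0 < |z.2| + |z.1| + 1 := fun z => by positivity
  have Hψ : ∀ z, HasFDerivAt (fun z => ∑' n, δ n z) (∑' n, fderiv ℝ (δ n) z) z :=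
    fun z => ((hloc _ (hpos z)).1 z (hmem z)).1
  have Hg' : ∀ z, HasFDerivAt (fun z => ∑' n, fderiv ℝ (δ n) z) (∑' n, fderiv ℝ (fderiv ℝ (δ n)) z) z :=
    fun z => ((hloc _ (hpos z)).1 z (hmem z)).2
  have Hg''c : Continuous fun z => ∑' n, fderiv ℝ (fderiv ℝ (δ n)) z := by
    refine continuous_iff_continuousAt.2 fun z => ?_
    exact (hloc _ (hpos z)).2.1.continuousAt
      ((isOpen_lt (by fun_prop) continuous_const).mem_nhds (hmem z))
  have hψd : Differentiable ℝ fun z => ∑' n, δ n z := fun z => (Hψ z).differentiableAt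
  have hfψ : fderiv ℝ (fun z => ∑' n, δ n z) = fun z => ∑' n, fderiv ℝ (δ n) z :=
    funext fun z => (Hψ z).fderiv
  have hg'd : Differentiable ℝ fun z => ∑' n, fderiv ℝ (δ n) z := fun z => (Hg' z).differentiableAt
  have hfg' : fderiv ℝ (fun z => ∑' n, fderiv ℝ (δ n) z) = fun z => ∑' n, fderiv ℝ (fderiv ℝ (δ n)) z :=
    funext fun z => (Hg' z).fderiv
  have h1 : ContDiff ℝ 1 fun z => ∑' n, fderiv ℝ (δ n) z :=
    contDiff_one_iff_fderiv.2 ⟨hg'd, by rw [hfg']; exact Hg''c⟩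
  have h2 : ContDiff ℝ ((1 : ℕ∞ω) + 1) fun z => ∑' n, δ n z :=
    contDiff_succ_iff_fderiv.2 ⟨hψd, fun h => absurd h (by norm_cast), by rw [hfψ]; exact h1⟩
  refine ⟨h2, fun z => ((hloc _ (hpos z)).2.2 z (hmem z)).1,
    fun z => ⟨((hloc _ (hpos z)).2.2 z (hmem z)).2.1, by rw [hfψ]⟩,
    fun z => ⟨((hloc _ (hpos z)).2.2 z (hmem z)).2.2, by rw [hfψ, hfg']⟩⟩

/-- Evaluation of a summable series of bilinear maps. -/
theorem tsum_apply_apply {T : ℕ → (ℝ × ℝ →L[ℝ] ℝ × ℝ →L[ℝ] ℝ)} (hT : Summable T) (v w : ℝ × ℝ) :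
    (Summable fun n => T n v w) ∧ (∑' n, T n) v w = ∑' n, T n v w := by
  have h1 : (∑' n, T n) v = ∑' n, T n v := by
    have := (ContinuousLinearMap.apply ℝ (ℝ × ℝ →L[ℝ] ℝ) v).map_tsum hT
    simpa using this
  have hT' : Summable fun n => T n v := by
    have := (ContinuousLinearMap.apply ℝ (ℝ × ℝ →L[ℝ] ℝ) v).summable hT
    simpa using this
  have hT'' : Summable fun n => T n v w := by
    have := (ContinuousLinearMap.apply ℝ ℝ w).summable hT'
    simpa using this
  refine ⟨hT'', ?_⟩
  rw [h1]
  have := (ContinuousLinearMap.apply ℝ ℝ w).map_tsum hT'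
  simpa using this

/-- Evaluation of a summable series of linear maps. -/
theorem tsum_apply' {T : ℕ → (ℝ × ℝ →L[ℝ] ℝ)} (hT : Summable T) (v : ℝ × ℝ) :
    (Summable fun n => T n v) ∧ (∑' n, T n) v = ∑' n, T n v := by
  have hT' : Summable fun n => T n v := by
    have := (ContinuousLinearMap.apply ℝ ℝ v).summable hT
    simpa using this
  refine ⟨hT', ?_⟩
  have := (ContinuousLinearMap.apply ℝ ℝ v).map_tsum hT
  simpa using this

/-- **The Picard limit solves the Cauchy problem**: `□ψ + Vψ = 0` for `ψ = Σ δ n` if `□ψ₀ = 0`, with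
the Cauchy data of `ψ₀` (values and all first partials at `t = 0`). [folklore] -/
theorem picard_solution (hV : ContDiff ℝ 1 V) (hψ₀ : ContDiff ℝ 2 ψ₀)
    (hwave₀ : ∀ z : ℝ × ℝ, fderiv ℝ (fderiv ℝ ψ₀) z (1, 0) (1, 0) - fderiv ℝ (fderiv ℝ ψ₀) z (0, 1) (0, 1) = 0)
    (hδ0 : δ 0 = ψ₀)
    (hδ : ∀ n t x, δ (n + 1) (t, x) = (1 / 2) * ∫ s in (0 : ℝ)..t,
      ((∫ y in (0 : ℝ)..(x + (t - s)), -(V y * δ n (s, y)))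
        - ∫ y in (0 : ℝ)..(x - (t - s)), -(V y * δ n (s, y)))) :
    ContDiff ℝ 2 (fun z => ∑' n, δ n z) ∧
    (∀ z : ℝ × ℝ, fderiv ℝ (fderiv ℝ (fun z => ∑' n, δ n z)) z (1, 0) (1, 0)
      - fderiv ℝ (fderiv ℝ (fun z => ∑' n, δ n z)) z (0, 1) (0, 1) + V z.2 * (∑' n, δ n z) = 0) ∧
    (∀ x : ℝ, (∑' n, δ n (0, x)) = ψ₀ (0, x)) ∧
    (∀ (x : ℝ) (v : ℝ × ℝ), fderiv ℝ (fun z => ∑' n, δ n z) (0, x) v = fderiv ℝ ψ₀ (0, x) v) := by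
  obtain ⟨hC2, hs0, h1, h2⟩ := picard_limit hV hψ₀ hδ0 hδ
  refine ⟨hC2, fun z => ?_, fun x => ?_, fun x v => ?_⟩
  · -- the equation
    obtain ⟨hs2, e2⟩ := h2 z
    rw [e2]
    obtain ⟨hsa, ha⟩ := tsum_apply_apply hs2 (1, 0) (1, 0)
    obtain ⟨hsb, hb⟩ := tsum_apply_apply hs2 (0, 1) (0, 1)
    rw [ha, hb, ← Summable.tsum_sub hsa hsb]
    have hsw : Summable fun n => fderiv ℝ (fderiv ℝ (δ n)) z (1, 0) (1, 0)
        - fderiv ℝ (fderiv ℝ (δ n)) z (0, 1) (0, 1) := hsa.sub hsb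
    rw [hsw.tsum_eq_zero_add]
    have hw0 : fderiv ℝ (fderiv ℝ (δ 0)) z (1, 0) (1, 0) - fderiv ℝ (fderiv ℝ (δ 0)) z (0, 1) (0, 1) = 0 := by
      rw [hδ0]; exact hwave₀ z
    have hws : ∀ n, fderiv ℝ (fderiv ℝ (δ (n + 1))) z (1, 0) (1, 0)
        - fderiv ℝ (fderiv ℝ (δ (n + 1))) z (0, 1) (0, 1) = -(V z.2 * δ n z) :=
      fun n => wave_picard_succ hV hψ₀ hδ0 hδ n z
    simp_rw [hw0, hws]
    rw [tsum_neg, tsum_mul_left]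
    ring
  · -- the values at `t = 0`
    rw [(hs0 (0, x)).tsum_eq_zero_add]
    have : ∀ n, δ (n + 1) (0, x) = 0 := fun n => (picard_succ_zero hV hψ₀ hδ0 hδ n x (1, 0)).1
    simp_rw [this]
    rw [tsum_zero, add_zero, hδ0]
  · -- the first partials at `t = 0`
    obtain ⟨hs1, e1⟩ := h1 (0, x)
    rw [e1]
    obtain ⟨hs1v, e1v⟩ := tsum_apply' hs1 v
    rw [e1v, hs1v.tsum_eq_zero_add]
    have : ∀ n, fderiv ℝ (δ (n + 1)) (0, x) v = 0 := fun n => (picard_succ_zero hV hψ₀ hδ0 hδ n x v).2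
    simp_rw [this]
    rw [tsum_zero, add_zero, hδ0]

end PicardLimit

/-! ### The free solution with odd data `(0, g)` -/

section Free

variable {g : ℝ → ℝ} {u₀ : ℝ × ℝ → ℝ}

/-- Chain rule along `z ↦ z.2 + c z.1` for a differentiable `H : ℝ → ℝ`. -/
theorem hasFDerivAt_comp_affine_real {H : ℝ → ℝ} (hH : Differentiable ℝ H) (c : ℝ) (z : ℝ × ℝ) :
    HasFDerivAt (fun z : ℝ × ℝ => H (z.2 + c * z.1))
      (deriv H (z.2 + c * z.1) • (ContinuousLinearMap.snd ℝ ℝ ℝ + c • ContinuousLinearMap.fst ℝ ℝ ℝ)) z := by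
  have hℓ : HasFDerivAt (fun z : ℝ × ℝ => z.2 + c * z.1)
      (ContinuousLinearMap.snd ℝ ℝ ℝ + c • ContinuousLinearMap.fst ℝ ℝ ℝ) z := by
    refine ((ContinuousLinearMap.snd ℝ ℝ ℝ + c • ContinuousLinearMap.fst ℝ ℝ ℝ).hasFDerivAt (x := z)).congr_of_eventuallyEq (Eventually.of_forall fun q => ?_)
    simp only [add_apply, ContinuousLinearMap.coe_snd', smul_apply, ContinuousLinearMap.coe_fst',
      smul_eq_mul]
  exact (hH _).hasDerivAt.comp_hasFDerivAt z hℓ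

/-- **The free solution with Cauchy data `(0, g)`** (`g ∈ C¹`): `u₀ (t, x) = ½ (G(x+t) − G(x−t))`,
`G` the primitive of `g`, is `C²`, solves `u_tt − u_xx = 0`, and has `u₀(0,·) = 0`,
`∂u₀(0,x)(v) = v₁ g(x)` (d'Alembert). [folklore] -/
theorem free_solution_odd (hg : ContDiff ℝ 1 g)
    (hu₀ : ∀ z : ℝ × ℝ, u₀ z = (1 / 2) * ((∫ y in (0 : ℝ)..(z.2 + z.1), g y) - ∫ y in (0 : ℝ)..(z.2 - z.1), g y)) :
    ContDiff ℝ 2 u₀ ∧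
    (∀ z : ℝ × ℝ, fderiv ℝ (fderiv ℝ u₀) z (1, 0) (1, 0) - fderiv ℝ (fderiv ℝ u₀) z (0, 1) (0, 1) = 0) ∧
    (∀ x : ℝ, u₀ (0, x) = 0) ∧
    (∀ (x : ℝ) (v : ℝ × ℝ), fderiv ℝ u₀ (0, x) v = v.1 * g x) := by
  set G : ℝ → ℝ := fun z => ∫ y in (0 : ℝ)..z, g y with hGdef
  have hgc : Continuous g := hg.continuous
  have hG' : ∀ z, HasDerivAt G (g z) z := fun z =>
    intervalIntegral.integral_hasDerivAt_right (hgc.intervalIntegrable _ _)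
      hgc.aestronglyMeasurable.stronglyMeasurableAtFilter hgc.continuousAt
  have hGd : Differentiable ℝ G := fun z => (hG' z).differentiableAt
  have hGderiv : deriv G = g := funext fun z => (hG' z).deriv
  have hG2 : ContDiff ℝ 2 G := by
    have : ContDiff ℝ ((1 : ℕ∞ω) + 1) G := by
      rw [contDiff_succ_iff_deriv]
      exact ⟨hGd, fun h => absurd h (by norm_cast), by rw [hGderiv]; exact hg⟩
    exact this
  set ℓp : ℝ × ℝ →L[ℝ] ℝ := ContinuousLinearMap.snd ℝ ℝ ℝ + (1 : ℝ) • ContinuousLinearMap.fst ℝ ℝ ℝ with hℓp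
  set ℓm : ℝ × ℝ →L[ℝ] ℝ := ContinuousLinearMap.snd ℝ ℝ ℝ + (-1 : ℝ) • ContinuousLinearMap.fst ℝ ℝ ℝ with hℓm
  have hu₀' : u₀ = fun z : ℝ × ℝ => (1 / 2 : ℝ) * (G (z.2 + 1 * z.1) - G (z.2 + (-1) * z.1)) := by
    funext z
    rw [hu₀ z]
    simp only [hGdef, one_mul, neg_one_mul, ← sub_eq_add_neg]
  -- first derivative
  have hD1 : ∀ z : ℝ × ℝ, HasFDerivAt u₀
      ((1 / 2 : ℝ) • (g (z.2 + 1 * z.1) • ℓp - g (z.2 + (-1) * z.1) • ℓm)) z := by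
    intro z
    rw [hu₀']
    have h := ((hasFDerivAt_comp_affine_real hGd 1 z).sub (hasFDerivAt_comp_affine_real hGd (-1) z)).const_mul
      (1 / 2 : ℝ)
    simp only [hGderiv] at h
    exact h
  have hfd : fderiv ℝ u₀ = fun z : ℝ × ℝ =>
      (1 / 2 : ℝ) • (g (z.2 + 1 * z.1) • ℓp - g (z.2 + (-1) * z.1) • ℓm) := funext fun z => (hD1 z).fderiv
  -- second derivative
  have hgd : Differentiable ℝ g := hg.differentiable (by simp)
  have hD2 : ∀ z : ℝ × ℝ, HasFDerivAt (fderiv ℝ u₀)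
      ((1 / 2 : ℝ) • ((deriv g (z.2 + 1 * z.1) • ℓp).smulRight ℓp
        - (deriv g (z.2 + (-1) * z.1) • ℓm).smulRight ℓm)) z := by
    intro z
    rw [hfd]
    exact (((hasFDerivAt_comp_affine_real hgd 1 z).smul_const ℓp).sub
      ((hasFDerivAt_comp_affine_real hgd (-1) z).smul_const ℓm)).const_smul (1 / 2 : ℝ)
  refine ⟨?_, fun z => ?_, fun x => ?_, fun x v => ?_⟩
  · rw [hu₀']
    exact contDiff_const.mul ((hG2.comp (by fun_prop)).sub (hG2.comp (by fun_prop)))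
  · rw [(hD2 z).fderiv]
    simp only [smul_apply, sub_apply, ContinuousLinearMap.smulRight_apply, add_apply,
      ContinuousLinearMap.coe_snd', ContinuousLinearMap.coe_fst', smul_eq_mul, hℓp, hℓm]
    ring
  · rw [hu₀]
    simp
  · rw [(hD1 (0, x)).fderiv]
    simp only [smul_apply, sub_apply, add_apply, ContinuousLinearMap.coe_snd',
      ContinuousLinearMap.coe_fst', smul_eq_mul, hℓp, hℓm, mul_zero, add_zero]
    ring

end Free

/-! ### The Cauchy problem with odd data for a general `C¹` potential -/

section CauchyProblem

/-- **Global `C²` solutions of `ψ_tt − ψ_xx + V ψ = 0` with Cauchy data `(0, g)`** (`V ∈ C¹`,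
`g ∈ C¹`): existence by Picard iteration of the Duhamel operator from the free solution, in the
Fréchet formulation on `ℝ × ℝ`. [folklore] -/
theorem exists_solution_odd_data {V : ℝ → ℝ} (hV : ContDiff ℝ 1 V) {g : ℝ → ℝ} (hg : ContDiff ℝ 1 g) :
    ∃ u : ℝ × ℝ → ℝ, ContDiff ℝ 2 u ∧
      (∀ z : ℝ × ℝ, fderiv ℝ (fderiv ℝ u) z (1, 0) (1, 0) - fderiv ℝ (fderiv ℝ u) z (0, 1) (0, 1)
        + V z.2 * u z = 0) ∧
      (∀ x : ℝ, u (0, x) = 0) ∧ (∀ (x : ℝ) (v : ℝ × ℝ), fderiv ℝ u (0, x) v = v.1 * g x) := by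
  set u₀ : ℝ × ℝ → ℝ := fun z => (1 / 2) * ((∫ y in (0 : ℝ)..(z.2 + z.1), g y) - ∫ y in (0 : ℝ)..(z.2 - z.1), g y)
    with hu₀def
  obtain ⟨h0C2, h0wave, h0zero, h0deriv⟩ := free_solution_odd (u₀ := u₀) hg (fun z => rfl)
  -- the Picard iterates
  set δ : ℕ → ℝ × ℝ → ℝ := fun n => Nat.rec (motive := fun _ => ℝ × ℝ → ℝ) u₀
    (fun _ d => fun z : ℝ × ℝ => (1 / 2) * ∫ s in (0 : ℝ)..z.1,
      ((∫ y in (0 : ℝ)..(z.2 + (z.1 - s)), -(V y * d (s, y)))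
        - ∫ y in (0 : ℝ)..(z.2 - (z.1 - s)), -(V y * d (s, y)))) n with hδdef
  have hδ0 : δ 0 = u₀ := rfl
  have hδ : ∀ n t x, δ (n + 1) (t, x) = (1 / 2) * ∫ s in (0 : ℝ)..t,
      ((∫ y in (0 : ℝ)..(x + (t - s)), -(V y * δ n (s, y)))
        - ∫ y in (0 : ℝ)..(x - (t - s)), -(V y * δ n (s, y))) := fun n t x => rfl
  obtain ⟨hC2, hwave, hzero, hderiv⟩ := picard_solution hV h0C2 h0wave hδ0 hδ
  exact ⟨fun z => ∑' n, δ n z, hC2, hwave, fun x => (hzero x).trans (h0zero x),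
    fun x v => (hderiv x v).trans (h0deriv x v)⟩

end CauchyProblem

end WaveEnergy

end

end Summit.FinalStateConjecture.FinalStateConjecture.Theorems
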